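import Summits.Ventures.LatticeQCDFlow.Scoring.SUNOnePlaquetteHaarMGF
import Summits.Ventures.LatticeQCDFlow.Scoring.UNOnePlaquettePlaquetteRange
import HarnessLib

/-!
# The range and STRICT monotonicity of the `SU(N)` one-plaquette plaquette, `N ≥ 2`: `P(0) = 0`, `−1 < P < 1`, `P' > 0`

HONEST FRAMING: exact (Metropolis-corrected) sampling algorithms for lattice gauge theory;
figures of merit are autocorrelation/cost numbers at stated couplings and volumes; no
continuum-physics claim.

Venture `LatticeQCDFlow` (cell pub-lqcd), sub-topic `Scoring`; FANOUT row 5 (`s0-sun-a`), GEN-17.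
NEW WORK of the cell (placement rule).  The sanity envelope of theory-2's `SU(N)` one-plaquette plaquette
`P^{SU(N)}(β) := ∫ (1/N) Re tr U e^{−β(N − Re tr U)} dU / ∫ e^{−β(N − Re tr U)} dU` (Haar measure on `SU(N)`; the venture's
`SU(2)`, `SU(3)` oracles are `N = 2, 3`), complementing `SUNOnePlaquetteHaarMGF` (monotone, slope at `0`, limit `1`):

* §1 `P^{SU(N)}(0) = 0` and the sign of `P^{SU(N)}(β)` (`N ≥ 2`; for `N = 1` the plaquette is identically `1`);
* §2 the centre element `e^{2πi/N}·1 ∈ SU(N)` has `Re tr = N cos(2π/N) < N` (`N ≥ 2`), so `{Re tr U < N}` is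
  Haar-non-null, and **`−1 < P^{SU(N)}(β) < 1`** for every real `β` (`N ≥ 2`, resp. `N ≥ 1` for the lower bound),
  by the abstract tilted-law bounds of `UNOnePlaquettePlaquetteRange`;
* §3 **`(P^{SU(N)})'(β) = (1/N)(log Σ_q det[I_{|q+i−j|}])''(β) = N·Var_β > 0`: STRICTLY increasing** (`N ≥ 2`), so
  `P^{SU(N)}(β) > 0` for `β > 0` — GEN-16's `SU(2)`/`SU(3)` monotonicity, now strict and for every `N`.

No `def`, nothing cited as a fact, 0 sorry.
-/

noncomputable section

open Real MeasureTheory Filter Topology Finset Complex Set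
open scoped ENNReal
open ProbabilityTheory
open Literature.MathematicalPhysics.QuantumFieldTheory
open Literature.MathematicalPhysics.QuantumLattice
open Literature.Analysis.FunctionSpaces

namespace Summit.Ventures.LatticeQCDFlow.Scoring

/-! ### 1. `P^{SU(N)}(0) = 0` and the sign -/

/-- **`P^{SU(N)}(0) = 0`** for `N ≥ 2`: at `β = 0` the plaquette is `(1/N) ∫_{SU(N)} Re tr U dU = 0`. -/
theorem specialUnitary_plaquette_zero (N : ℕ) (hN : 2 ≤ N) :
    (∫ u, ((u : Matrix.specialUnitaryGroup (Fin N) ℂ) : Matrix (Fin N) (Fin N) ℂ).trace.re / N *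
          Real.exp (-((0 : ℝ) * ((N : ℝ) - ((u : Matrix.specialUnitaryGroup (Fin N) ℂ) :
            Matrix (Fin N) (Fin N) ℂ).trace.re))) ∂(haarProbability (Matrix.specialUnitaryGroup (Fin N) ℂ)))
      / (∫ u, Real.exp (-((0 : ℝ) * ((N : ℝ) - ((u : Matrix.specialUnitaryGroup (Fin N) ℂ) :
          Matrix (Fin N) (Fin N) ℂ).trace.re))) ∂(haarProbability (Matrix.specialUnitaryGroup (Fin N) ℂ))) = 0 := by
  haveI : NeZero N := ⟨by omega⟩
  rw [specialUnitary_plaquette_eq_deriv_log_tsum_det, deriv_log_tsum_det_besselI_zero N hN, mul_zero]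

/-- `P^{SU(N)}(β) ≥ 0` for `β ≥ 0`, `N ≥ 2`. -/
theorem specialUnitary_plaquette_nonneg (N : ℕ) (hN : 2 ≤ N) {β : ℝ} (hβ : 0 ≤ β) :
    0 ≤ (∫ u, ((u : Matrix.specialUnitaryGroup (Fin N) ℂ) : Matrix (Fin N) (Fin N) ℂ).trace.re / N *
          Real.exp (-(β * ((N : ℝ) - ((u : Matrix.specialUnitaryGroup (Fin N) ℂ) :
            Matrix (Fin N) (Fin N) ℂ).trace.re))) ∂(haarProbability (Matrix.specialUnitaryGroup (Fin N) ℂ)))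
      / (∫ u, Real.exp (-(β * ((N : ℝ) - ((u : Matrix.specialUnitaryGroup (Fin N) ℂ) :
          Matrix (Fin N) (Fin N) ℂ).trace.re))) ∂(haarProbability (Matrix.specialUnitaryGroup (Fin N) ℂ))) := by
  haveI : NeZero N := ⟨by omega⟩
  have h := monotone_specialUnitary_plaquette N hβ
  dsimp only at h
  rwa [specialUnitary_plaquette_zero N hN] at h

/-- `P^{SU(N)}(β) ≤ 0` for `β ≤ 0`, `N ≥ 2`. -/
theorem specialUnitary_plaquette_nonpos (N : ℕ) (hN : 2 ≤ N) {β : ℝ} (hβ : β ≤ 0) :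
    (∫ u, ((u : Matrix.specialUnitaryGroup (Fin N) ℂ) : Matrix (Fin N) (Fin N) ℂ).trace.re / N *
          Real.exp (-(β * ((N : ℝ) - ((u : Matrix.specialUnitaryGroup (Fin N) ℂ) :
            Matrix (Fin N) (Fin N) ℂ).trace.re))) ∂(haarProbability (Matrix.specialUnitaryGroup (Fin N) ℂ)))
      / (∫ u, Real.exp (-(β * ((N : ℝ) - ((u : Matrix.specialUnitaryGroup (Fin N) ℂ) :
          Matrix (Fin N) (Fin N) ℂ).trace.re))) ∂(haarProbability (Matrix.specialUnitaryGroup (Fin N) ℂ))) ≤ 0 := by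
  haveI : NeZero N := ⟨by omega⟩
  have h := monotone_specialUnitary_plaquette N hβ
  dsimp only at h
  rwa [specialUnitary_plaquette_zero N hN] at h

/-! ### 2. `−1 < P^{SU(N)}(β) < 1` -/

/-- `Re tr U ≤ N` on `SU(N)`. -/
theorem trace_re_le_card_su {n : Type*} [Fintype n] [DecidableEq n] (u : Matrix.specialUnitaryGroup n ℂ) :
    ((u : Matrix.specialUnitaryGroup n ℂ) : Matrix n n ℂ).trace.re ≤ Fintype.card n :=
  (abs_le.mp (abs_trace_re_le_card_su u)).2

/-- `−N ≤ Re tr U` on `SU(N)`. -/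
theorem neg_card_le_trace_re_su {n : Type*} [Fintype n] [DecidableEq n] (u : Matrix.specialUnitaryGroup n ℂ) :
    -(Fintype.card n : ℝ) ≤ ((u : Matrix.specialUnitaryGroup n ℂ) : Matrix n n ℂ).trace.re :=
  (abs_le.mp (abs_trace_re_le_card_su u)).1

/-- **The centre element** `e^{2πi/N}·1 ∈ SU(N)`. -/
theorem diagonal_exp_two_pi_div_mem_specialUnitaryGroup (N : ℕ) [NeZero N] :
    Matrix.diagonal (fun _ : Fin N => Complex.exp ((2 * π / N : ℝ) * I)) ∈ Matrix.specialUnitaryGroup (Fin N) ℂ := by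
  refine (diagonal_mem_specialUnitaryGroup_iff _).mpr ⟨fun _ => Complex.norm_exp_ofReal_mul_I _, ?_⟩
  rw [Finset.prod_const, Finset.card_univ, Fintype.card_fin, ← Complex.exp_nat_mul]
  have hN : (N : ℂ) ≠ 0 := Nat.cast_ne_zero.2 (NeZero.ne N)
  rw [show (N : ℂ) * (((2 * π / N : ℝ) : ℂ) * I) = 2 * π * I by push_cast; field_simp]
  exact Complex.exp_two_pi_mul_I

/-- Its trace has real part `N cos(2π/N) < N` when `N ≥ 2`. -/
theorem trace_re_diagonal_exp_two_pi_div_lt (N : ℕ) (hN : 2 ≤ N) :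
    (Matrix.diagonal (fun _ : Fin N => Complex.exp ((2 * π / N : ℝ) * I))).trace.re < N := by
  rw [Matrix.trace_diagonal, Finset.sum_const, Finset.card_univ, Fintype.card_fin, nsmul_eq_mul, Complex.mul_re,
    Complex.natCast_re, Complex.natCast_im, zero_mul, sub_zero, Complex.exp_ofReal_mul_I_re]
  have hNpos : (0 : ℝ) < N := by exact_mod_cast (show 0 < N by omega)
  have hN1 : (1 : ℝ) < N := by exact_mod_cast (show 1 < N by omega)
  have hθpos : 0 < 2 * π / N := div_pos Real.two_pi_pos hNpos
  have hθlt : 2 * π / N < 2 * π := div_lt_self Real.two_pi_pos hN1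
  have hcos : Real.cos (2 * π / N) < 1 := (Real.cos_le_one _).lt_of_ne fun h =>
    hθpos.ne' ((Real.cos_eq_one_iff_of_lt_of_lt (by linarith) hθlt).1 h)
  calc (N : ℝ) * Real.cos (2 * π / N) < N * 1 := mul_lt_mul_of_pos_left hcos hNpos
    _ = N := mul_one _

/-- The set `{Re tr U < N}` has positive Haar measure in `SU(N)`, `N ≥ 2` (open, contains `e^{2πi/N}·1`). -/
theorem haar_specialUnitaryGroup_trace_re_lt_card_pos (N : ℕ) (hN : 2 ≤ N) :
    0 < haarProbability (Matrix.specialUnitaryGroup (Fin N) ℂ)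
      {u | ((u : Matrix.specialUnitaryGroup (Fin N) ℂ) : Matrix (Fin N) (Fin N) ℂ).trace.re < N} := by
  haveI : NeZero N := ⟨by omega⟩
  haveI : (haarProbability (Matrix.specialUnitaryGroup (Fin N) ℂ)).IsHaarMeasure :=
    Measure.isHaarMeasure_haarMeasure ⊤
  have hopen : IsOpen {u : Matrix.specialUnitaryGroup (Fin N) ℂ |
      ((u : Matrix.specialUnitaryGroup (Fin N) ℂ) : Matrix (Fin N) (Fin N) ℂ).trace.re < N} :=
    isOpen_lt (Complex.continuous_re.comp (continuous_id.matrix_trace.comp continuous_subtype_val)) continuous_const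
  refine hopen.measure_pos _ ⟨⟨_, diagonal_exp_two_pi_div_mem_specialUnitaryGroup N⟩, ?_⟩
  simp only [Set.mem_setOf_eq]
  exact trace_re_diagonal_exp_two_pi_div_lt N hN

/-- The set `{−N < Re tr U}` has positive Haar measure in `SU(N)`, `N ≥ 1` (open, contains `1`). -/
theorem haar_specialUnitaryGroup_neg_card_lt_trace_re_pos (N : ℕ) [NeZero N] :
    0 < haarProbability (Matrix.specialUnitaryGroup (Fin N) ℂ)
      {u | -(N : ℝ) < ((u : Matrix.specialUnitaryGroup (Fin N) ℂ) : Matrix (Fin N) (Fin N) ℂ).trace.re} := by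
  haveI : (haarProbability (Matrix.specialUnitaryGroup (Fin N) ℂ)).IsHaarMeasure :=
    Measure.isHaarMeasure_haarMeasure ⊤
  have hopen : IsOpen {u : Matrix.specialUnitaryGroup (Fin N) ℂ |
      -(N : ℝ) < ((u : Matrix.specialUnitaryGroup (Fin N) ℂ) : Matrix (Fin N) (Fin N) ℂ).trace.re} :=
    isOpen_lt continuous_const (Complex.continuous_re.comp (continuous_id.matrix_trace.comp continuous_subtype_val))
  refine hopen.measure_pos _ ⟨1, ?_⟩
  simp only [Set.mem_setOf_eq]
  rw [show (((1 : Matrix.specialUnitaryGroup (Fin N) ℂ)) : Matrix (Fin N) (Fin N) ℂ) = 1 from rfl, Matrix.trace_one]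
  simp only [Complex.natCast_re, Fintype.card_fin]
  have hN : (0 : ℝ) < N := Nat.cast_pos.2 (Nat.pos_of_neZero N)
  linarith

/-- **`P^{SU(N)}(β) < 1`** for every real `β` and `N ≥ 2`. -/
theorem specialUnitary_plaquette_lt_one (N : ℕ) (hN : 2 ≤ N) (β : ℝ) :
    (∫ u, ((u : Matrix.specialUnitaryGroup (Fin N) ℂ) : Matrix (Fin N) (Fin N) ℂ).trace.re / N *
          Real.exp (-(β * ((N : ℝ) - ((u : Matrix.specialUnitaryGroup (Fin N) ℂ) :
            Matrix (Fin N) (Fin N) ℂ).trace.re))) ∂(haarProbability (Matrix.specialUnitaryGroup (Fin N) ℂ)))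
      / (∫ u, Real.exp (-(β * ((N : ℝ) - ((u : Matrix.specialUnitaryGroup (Fin N) ℂ) :
          Matrix (Fin N) (Fin N) ℂ).trace.re))) ∂(haarProbability (Matrix.specialUnitaryGroup (Fin N) ℂ))) < 1 := by
  haveI : NeZero N := ⟨by omega⟩
  have hNpos : (0 : ℝ) < N := Nat.cast_pos.2 (Nat.pos_of_neZero N)
  exact tilted_ratio_lt_one (μ := haarProbability (Matrix.specialUnitaryGroup (Fin N) ℂ))
    (aestronglyMeasurable_trace_re_specialUnitaryGroup N) (fun u => abs_trace_re_le_card_su u) hNpos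
    (fun u => by simpa [Fintype.card_fin] using trace_re_le_card_su u)
    (haar_specialUnitaryGroup_trace_re_lt_card_pos N hN) β

/-- **`−1 < P^{SU(N)}(β)`** for every real `β` and `N ≥ 1`. -/
theorem neg_one_lt_specialUnitary_plaquette (N : ℕ) [NeZero N] (β : ℝ) :
    -1 < (∫ u, ((u : Matrix.specialUnitaryGroup (Fin N) ℂ) : Matrix (Fin N) (Fin N) ℂ).trace.re / N *
          Real.exp (-(β * ((N : ℝ) - ((u : Matrix.specialUnitaryGroup (Fin N) ℂ) :
            Matrix (Fin N) (Fin N) ℂ).trace.re))) ∂(haarProbability (Matrix.specialUnitaryGroup (Fin N) ℂ)))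
      / (∫ u, Real.exp (-(β * ((N : ℝ) - ((u : Matrix.specialUnitaryGroup (Fin N) ℂ) :
          Matrix (Fin N) (Fin N) ℂ).trace.re))) ∂(haarProbability (Matrix.specialUnitaryGroup (Fin N) ℂ))) := by
  have hNpos : (0 : ℝ) < N := Nat.cast_pos.2 (Nat.pos_of_neZero N)
  exact neg_one_lt_tilted_ratio (μ := haarProbability (Matrix.specialUnitaryGroup (Fin N) ℂ))
    (aestronglyMeasurable_trace_re_specialUnitaryGroup N) (fun u => abs_trace_re_le_card_su u) hNpos
    (fun u => by simpa [Fintype.card_fin] using neg_card_le_trace_re_su u)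
    (haar_specialUnitaryGroup_neg_card_lt_trace_re_pos N) β

/-! ### 3. Strict monotonicity: `P' = (1/N)(log Z)'' = N · Var > 0` -/

/-- **The tilted plaquette variance is positive on `SU(N)`, `N ≥ 2`.** -/
theorem specialUnitary_plaquette_variance_pos (N : ℕ) (hN : 2 ≤ N) (β : ℝ) :
    0 < (∫ u, (((u : Matrix.specialUnitaryGroup (Fin N) ℂ) : Matrix (Fin N) (Fin N) ℂ).trace.re / N) ^ 2 *
          Real.exp (-(β * ((N : ℝ) - ((u : Matrix.specialUnitaryGroup (Fin N) ℂ) : Matrix (Fin N) (Fin N) ℂ).trace.re)))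
        ∂(haarProbability (Matrix.specialUnitaryGroup (Fin N) ℂ)))
      / (∫ u, Real.exp (-(β * ((N : ℝ) - ((u : Matrix.specialUnitaryGroup (Fin N) ℂ) :
          Matrix (Fin N) (Fin N) ℂ).trace.re))) ∂(haarProbability (Matrix.specialUnitaryGroup (Fin N) ℂ)))
      - ((∫ u, ((u : Matrix.specialUnitaryGroup (Fin N) ℂ) : Matrix (Fin N) (Fin N) ℂ).trace.re / N *
          Real.exp (-(β * ((N : ℝ) - ((u : Matrix.specialUnitaryGroup (Fin N) ℂ) : Matrix (Fin N) (Fin N) ℂ).trace.re)))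
        ∂(haarProbability (Matrix.specialUnitaryGroup (Fin N) ℂ)))
      / (∫ u, Real.exp (-(β * ((N : ℝ) - ((u : Matrix.specialUnitaryGroup (Fin N) ℂ) :
          Matrix (Fin N) (Fin N) ℂ).trace.re))) ∂(haarProbability (Matrix.specialUnitaryGroup (Fin N) ℂ)))) ^ 2 := by
  haveI : NeZero N := ⟨by omega⟩
  exact tilted_variance_pos (μ := haarProbability (Matrix.specialUnitaryGroup (Fin N) ℂ))
    (aestronglyMeasurable_trace_re_specialUnitaryGroup N) (fun u => abs_trace_re_le_card_su u)
    (Nat.cast_pos.2 (Nat.pos_of_neZero N)) (fun u => by simpa [Fintype.card_fin] using trace_re_le_card_su u)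
    (haar_specialUnitaryGroup_trace_re_lt_card_pos N hN) (fun ε hε => haar_specialUnitaryGroup_trace_re_gt_pos N hε) β

/-- `P^{SU(N)}` is differentiable with **`(P^{SU(N)})'(β) = (1/N)(log Σ_q det[I_{|q+i−j|}])''(β)`** (`N ≥ 1`). -/
theorem hasDerivAt_specialUnitary_plaquette (N : ℕ) [NeZero N] (β : ℝ) :
    HasDerivAt (fun β : ℝ =>
      (∫ u, ((u : Matrix.specialUnitaryGroup (Fin N) ℂ) : Matrix (Fin N) (Fin N) ℂ).trace.re / N *
          Real.exp (-(β * ((N : ℝ) - ((u : Matrix.specialUnitaryGroup (Fin N) ℂ) : Matrix (Fin N) (Fin N) ℂ).trace.re)))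
        ∂(haarProbability (Matrix.specialUnitaryGroup (Fin N) ℂ)))
      / (∫ u, Real.exp (-(β * ((N : ℝ) - ((u : Matrix.specialUnitaryGroup (Fin N) ℂ) :
          Matrix (Fin N) (Fin N) ℂ).trace.re))) ∂(haarProbability (Matrix.specialUnitaryGroup (Fin N) ℂ))))
      (1 / N * iteratedDeriv 2 (fun x : ℝ =>
        Real.log (∑' q : ℤ, (Matrix.of fun i j : Fin N => besselI (q + (i : ℤ) - (j : ℤ)).natAbs x).det)) β) β := by
  simp_rw [specialUnitary_plaquette_eq_deriv_log_tsum_det]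
  have ha := analyticOnNhd_cgf_univ (aestronglyMeasurable_trace_re_specialUnitaryGroup N)
    (fun u => abs_trace_re_le_card_su u)
  have hcgf : (fun x : ℝ => Real.log (∑' q : ℤ, (Matrix.of fun i j : Fin N =>
      besselI (q + (i : ℤ) - (j : ℤ)).natAbs x).det))
      = cgf (fun u : Matrix.specialUnitaryGroup (Fin N) ℂ => ((u : Matrix.specialUnitaryGroup (Fin N) ℂ) :
          Matrix (Fin N) (Fin N) ℂ).trace.re) (haarProbability (Matrix.specialUnitaryGroup (Fin N) ℂ)) :=
    funext fun x => by rw [cgf, mgf_trace_re_specialUnitaryGroup]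
  rw [iteratedDeriv_succ, iteratedDeriv_one]
  have hd : HasDerivAt (deriv fun x : ℝ => Real.log (∑' q : ℤ, (Matrix.of fun i j : Fin N =>
      besselI (q + (i : ℤ) - (j : ℤ)).natAbs x).det))
      (deriv (deriv fun x : ℝ => Real.log (∑' q : ℤ, (Matrix.of fun i j : Fin N =>
        besselI (q + (i : ℤ) - (j : ℤ)).natAbs x).det)) β) β := by
    rw [hcgf]
    exact ((ha β (Set.mem_univ β)).deriv).differentiableAt.hasDerivAt
  exact hd.const_mul (1 / (N : ℝ))

/-- **`(P^{SU(N)})'(β) > 0`** for every real `β` and `N ≥ 2`. -/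
theorem deriv_specialUnitary_plaquette_pos (N : ℕ) (hN : 2 ≤ N) (β : ℝ) :
    0 < deriv (fun β : ℝ =>
      (∫ u, ((u : Matrix.specialUnitaryGroup (Fin N) ℂ) : Matrix (Fin N) (Fin N) ℂ).trace.re / N *
          Real.exp (-(β * ((N : ℝ) - ((u : Matrix.specialUnitaryGroup (Fin N) ℂ) : Matrix (Fin N) (Fin N) ℂ).trace.re)))
        ∂(haarProbability (Matrix.specialUnitaryGroup (Fin N) ℂ)))
      / (∫ u, Real.exp (-(β * ((N : ℝ) - ((u : Matrix.specialUnitaryGroup (Fin N) ℂ) :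
          Matrix (Fin N) (Fin N) ℂ).trace.re))) ∂(haarProbability (Matrix.specialUnitaryGroup (Fin N) ℂ)))) β := by
  haveI : NeZero N := ⟨by omega⟩
  rw [(hasDerivAt_specialUnitary_plaquette N β).deriv]
  have hpos := specialUnitary_plaquette_variance_pos N hN β
  rw [specialUnitary_plaquette_variance_eq] at hpos
  have hNpos : (0 : ℝ) < N := Nat.cast_pos.2 (Nat.pos_of_neZero N)
  have h2 : 0 < iteratedDeriv 2 (fun x : ℝ =>
      Real.log (∑' q : ℤ, (Matrix.of fun i j : Fin N => besselI (q + (i : ℤ) - (j : ℤ)).natAbs x).det)) β :=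
    (mul_pos_iff_of_pos_left (by positivity)).1 hpos
  positivity

/-- **THE `SU(N)` ONE-PLAQUETTE PLAQUETTE IS STRICTLY INCREASING IN THE COUPLING**, for every `N ≥ 2`. -/
theorem strictMono_specialUnitary_plaquette (N : ℕ) (hN : 2 ≤ N) :
    StrictMono fun β : ℝ =>
      (∫ u, ((u : Matrix.specialUnitaryGroup (Fin N) ℂ) : Matrix (Fin N) (Fin N) ℂ).trace.re / N *
          Real.exp (-(β * ((N : ℝ) - ((u : Matrix.specialUnitaryGroup (Fin N) ℂ) : Matrix (Fin N) (Fin N) ℂ).trace.re)))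
        ∂(haarProbability (Matrix.specialUnitaryGroup (Fin N) ℂ)))
      / (∫ u, Real.exp (-(β * ((N : ℝ) - ((u : Matrix.specialUnitaryGroup (Fin N) ℂ) :
          Matrix (Fin N) (Fin N) ℂ).trace.re))) ∂(haarProbability (Matrix.specialUnitaryGroup (Fin N) ℂ))) :=
  strictMono_of_deriv_pos fun β => deriv_specialUnitary_plaquette_pos N hN β

/-- `P^{SU(N)}(β) > 0` for `β > 0` (`N ≥ 2`). -/
theorem specialUnitary_plaquette_pos (N : ℕ) (hN : 2 ≤ N) {β : ℝ} (hβ : 0 < β) :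
    0 < (∫ u, ((u : Matrix.specialUnitaryGroup (Fin N) ℂ) : Matrix (Fin N) (Fin N) ℂ).trace.re / N *
          Real.exp (-(β * ((N : ℝ) - ((u : Matrix.specialUnitaryGroup (Fin N) ℂ) :
            Matrix (Fin N) (Fin N) ℂ).trace.re))) ∂(haarProbability (Matrix.specialUnitaryGroup (Fin N) ℂ)))
      / (∫ u, Real.exp (-(β * ((N : ℝ) - ((u : Matrix.specialUnitaryGroup (Fin N) ℂ) :
          Matrix (Fin N) (Fin N) ℂ).trace.re))) ∂(haarProbability (Matrix.specialUnitaryGroup (Fin N) ℂ))) := by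
  have h := strictMono_specialUnitary_plaquette N hN hβ
  dsimp only at h
  rwa [specialUnitary_plaquette_zero N hN] at h

end Summit.Ventures.LatticeQCDFlow.Scoring
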